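import Summits.BirchSwinnertonDyer.Rank1Residual.Supersingular.KobayashiMainConjectureX7FouquetWanCrystalline
import Summits.BirchSwinnertonDyer.Rank1Residual.Supersingular.RankZeroUpperBoundProp48
import Summits.BirchSwinnertonDyer.BirchSwinnertonDyer.Theorems.SignedLowerHalvesKobayashiLowerHalfSemistableScopeS
import HarnessLib

/-!
# Route `SignedLowerHalves`, crux `KobayashiLowerHalfSemistable` (item stmt-BirchSwinnertonDyer-19000): the
# FOUQUET–WAN SUB-LOCUS of corner X6 — a second PRE road to the crux's conclusion that does not pass through
# Burungale–Skinner–Tian–Wan, and the crux BY NAME reduced to its OFF-locus part modulo the Fouquet–Wan §4.6 binder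
# (cell `bsd-ssimc`, seat `bsd-ssimc-k3-c2` gen 9; a `--supports … --as helper` file; THEOREMS ONLY; closes nothing)

PARTITION (cell bsd-ssimc, D-0054): X6 ∧ r = 0 (A6) × 13 (+10~) × p ∈ {3,5} + X6 r1 + literal row D2 — types-the-object-of
(the sub-locus of X6 where an X7 engine already typed in the tree also applies); closes NONE; nothing booked. HONEST FRAMING:
nothing here proves Kobayashi's conjecture for any curve; the binder `FouquetWan2021_thm451_via_kobayashi74_OPEN`
(Fouquet–Wan arXiv:2107.13726 Thm 4.51 — the §4.6 crystalline chain, with the SL₂(ℤ_p)-image hypothesis its proof invokes —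
read through Kobayashi 2003 Thm 7.4) transcribes an UNREFEREED preprint and enters ONLY as a hypothesis; BSD is not proved by
any of this; the item stays OPEN.

## What this file says

The kernel state of record of crux 2 (`KobayashiLowerHalfSemistable_of_tiersS_S3`, p441716) reads the crux BY NAME modulo the
two S-scoped Burungale–Skinner–Tian–Wan tiers (`…thm13_scopedS_OPEN` at `p ≥ 5`, `…thm13_scopedAtThreeS_OPEN` at `p = 3`,
the latter resting on the located residual (3-ii)♭ = Ohta's Λ-adic Eichler–Shimura at `3`, [SSV], not public) plus
modularity and Diamond/Ribet. The tree ALSO holds, for corner X7, the Fouquet–Wan binder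
`FouquetWan2021_thm451_via_kobayashi74_OPEN` (seat k3-c3, `KobayashiMainConjectureX7FouquetWanCrystalline.lean`), whose
hypotheses are CLASS-FREE: `p` odd of good reduction, `a_p = 0`, `E[p]` irreducible, Kato's (12.5.2)
`Kato2004.ImageContainsSL2 W p`, and a prime `ℓ ≠ p` of NON-SPLIT multiplicative reduction with `p ∤ ord_ℓ(Δ_min)` (the
"FW locus"). On corner X6 every one of these side conditions except the locus is a TREE THEOREM at EVERY odd `p`:
`ClassX6.frobeniusTrace_eq_zero`, `ClassX6.irr` (Serre Prop. 12), `ClassX6.imageContainsSL2` (Serre IV-23 at `p ≥ 5`,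
Wuthrich 2014 Lemma 20 at a good supersingular `3` — so the audit flag A-KATO-3 of lev MEMO-5-addB is VOID on X6 exactly as on
X7 ∩ {surj}). Hence:

* `X6_kobayashiMainConjecture_of_thm451_OPEN`, `X6_kobayashiLowerDivisibility_of_thm451_OPEN` — on X6 ∩ FW-locus, every
  odd `p` INCLUDING `3`, both signs, Kobayashi's main conjecture / its Eisenstein half MODULO THE §4.6 BINDER ALONE: no BSTW
  tier, no (3-ii)♭, no modularity / Diamond–Ribet binder (those were needed only to manufacture BSTW's auxiliary data);
  `…_of_thm51_OPEN` — the same from the §5 binder (which implies the §4.6 one, `thm451_OPEN_of_thm51_OPEN`);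
* `X6_bsdp_of_thm451_OPEN_of_analyticRank_eq_zero` (A6 on the locus) and `X6_bsdp_of_thm451_OPEN_of_corA5_of_analyticRank_eq_one`
  (D2 / X6 r1 on the locus) — the class consumers, every other input PUBLISHED and by name;
* `KobayashiLowerHalfSemistable_of_thm451_OPEN_of_offLocus` — **the crux BY NAME ⟸ {§4.6 FW binder, the crux's own
  conclusion on the OFF-locus pairs}**: modulo Fouquet–Wan, whatever else the crux is made to rest on (the BSTW tiers; at
  `p = 3` the [SSV]-dependent (3-ii)♭) is LOAD-BEARING ONLY on semistable curves all of whose multiplicative primes `ℓ ≠ p`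
  are split or have `p ∣ ord_ℓ(Δ_min)`;
* `KobayashiLowerHalfSemistable_of_thm451_OPEN_of_tiersS_S3_offLocus` — the same with the off-locus part supplied by the two
  S-scoped BSTW tiers RESTRICTED to off-locus pairs (displayed inline, weaker than the named binders) + modularity +
  Diamond/Ribet; and the sanity composition `…_of_thm451_OPEN_of_tiersS_S3` (the named tiers imply their restrictions, so
  this reading is never stronger than p441716 ∧ the FW binder).

Census (seat k3-c2 g9, local run of the planner's `bsd-ssimc-plan/census/fw_census.py` on Cremona ecdata, file
`HOME/k3c2/fw_a6.tsv`): ALL 13 A6 window cells lie on the FW locus at their prime — the twelve at `p = 3` (2534e1, 4343b1,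
4963c1, 5561a1, 8710b1, 12034a1, 15755a1, 16982a1, 17917b1, 19142a1, 19822e1, 19918b1) and 22678e1 at `5` (planner g8,
FW-CENSUS.md A6 addendum); 12 of 13 have an ODD witness prime, 19142a1's only witness is `ℓ = 2` (`ord₁₇ Δ = 3`).

Why this is worth a file (novelty, one paragraph). The cell's two located obstructions to USING Fouquet–Wan on corner X7 —
Wan, Algebra Number Theory 14 (2020) is printed for SQUARE-FREE level, and the local triple-product computation at an
ADDITIVE potentially-multiplicative prime is written nowhere (lev MEMO-5 §2, W-k3c3-4) — are ABSENT on X6 by definition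
(`N` square-free, no additive prime): semistable curves on the FW locus are the cleanest instance of Fouquet–Wan's claim, and
nobody had typed it there. At `p = 3` this is, AS TYPED, a road to the crux's conclusion on X6 ∩ FW-locus that does not pass
through BSTW Part I §3, hence not through (3-ii)♭ / [SSV].

What this is NOT: not a discharge of any binder (Fouquet–Wan is PRE: arXiv only, FRESHNESS 2026-08-26); not an audit — the
cell's Fouquet–Wan audit (lev MEMO-5 + addA–D, REPORT-lev-7 PASS; k3-c3 MEMO-1) is STATEMENT-level and was run for X7; a
PROOF-level audit of FW §4.6 at `p = 3` on square-free level (the [LLZ14]/[KLZ17] explicit reciprocity laws at `3`, Wan 2020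
/ Castella–Liu–Wan 2022 at `3`) is NOT on file, so no tier word attaches to the `p = 3` alternative until the planner orders
one; not a move on the crux (OPEN; kernel state of record unchanged = p441716); nothing booked; the 13 A6 cells are
meanwhile flag-free PER PAIR by other roads (Selmer-nine @ 3, visibility @ 5) — this file is about the CLASS statement.

References: [FouquetWan2021] Thm 4.51 / 1.13, Thm 4.41 = 7.32, Thm 5.1 (PRE); [Kobayashi2003] Thm 7.4 (p. 13), Conjecture
(p. 2), Thm 1.2; [Kato2004Asterisque] (12.5.2) in Thm 12.5 (4) (p. 222); [Wuthrich2014] Lemma 20 (p. 399), Prop. 21 (p. 400);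
[Serre1972] Prop. 12, §5.4 Prop. 21 (i); [SerreAbelianLadic1968] IV-23; [BDKim2013] Cor. 3.15; [Pollack2003];
[BurungaleKobayashiOta2023] App. A Cor. A.5; [BurungaleSkinnerTianWan2024] Thm 1.3 (PRE); [Ribet1990] Thm 1.1;
[Diamond1995RefinedSerre] Thm 1.1; [Miller2011LMS] Def. 1.1; cell records lev MEMO-5-addB (A-KATO-3), bsd-ssimc-plan
census/FW-CENSUS.md, k3c2-MEMO-8.
-/

set_option autoImplicit false
-- lint debt, justified: the tree's Theorems namespace `Summit.BirchSwinnertonDyer.BirchSwinnertonDyer.Theorems`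
-- repeats the summit name (single-conjunct summit, D-0017), which `linter.dupNamespace` flags on every declaration.
set_option linter.dupNamespace false

noncomputable section

open scoped Classical MatrixGroups ModularForm

open CongruenceSubgroup WeierstrassCurve NumberField Literature.NumberTheory.EllipticCurves
  Literature.NumberTheory.EllipticCurves.ModularForms
  Literature.NumberTheory.EllipticCurves.Rank1Residual
  Literature.NumberTheory.EllipticCurves.Rank1Residual.Typed
  Summit.BirchSwinnertonDyer.Rank1Residual.Supersingular

namespace Summit.BirchSwinnertonDyer.BirchSwinnertonDyer.Theorems

/-! ### X6 on the Fouquet–Wan locus, every odd `p`, modulo the §4.6 binder alone -/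

/-- **Kobayashi's main conjecture on X6 ∩ FW-locus at EVERY odd `p` (including `p = 3`), both signs, MODULO the Fouquet–Wan
§4.6 binder ALONE.** At an X6 pair (`E` semistable, `p` odd good supersingular, `p ≥ 5 ∨ a_3 = 0`) with a non-split
multiplicative prime `ℓ ≠ p`, `p ∤ ord_ℓ(Δ_min)`: `a_p = 0` (`ClassX6.frobeniusTrace_eq_zero`), `E[p]` irreducible
(`ClassX6.irr`) and Kato's (12.5.2) (`ClassX6.imageContainsSL2`: Serre IV-23 at `p ≥ 5`, Wuthrich Lemma 20 at `3`) are tree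
theorems, so the binder's hypotheses are met with NO further input. CONDITIONAL; closes nothing.
[claim: FouquetWan2021, status: under-review] [cite: Kobayashi2003, Thm. 7.4 (p. 13) and Conjecture (p. 2)]
[cite: Wuthrich2014, Lemma 20 (p. 399)] [cite: Kato2004Asterisque, (12.5.2) in Thm. 12.5 (4) (p. 222)] -/
theorem X6_kobayashiMainConjecture_of_thm451_OPEN (hFW : FouquetWan2021_thm451_via_kobayashi74_OPEN)
    (W : WeierstrassCurve ℚ) [W.IsElliptic] [W.IsGloballyMinimal] (p : ℕ) [Fact p.Prime]
    (hp : p ≠ 2) (hX : ClassX6 W p)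
    (hloc : ∃ (ℓ : ℕ) (_ : Fact ℓ.Prime), ℓ ≠ p ∧ W.HasMultiplicativeReductionAtPrime ℓ ∧
        ¬ W.HasSplitMultiplicativeReductionAtPrime ℓ ∧ ¬ p ∣ padicValInt ℓ W.minimalDiscriminantInt)
    (ε : ℤˣ) : KobayashiMainConjecture W p ε :=
  hFW W p hp hX.1.1 (ClassX6.frobeniusTrace_eq_zero W p hp hX) (ClassX6.irr W p hp hX)
    (ClassX6.imageContainsSL2 W p hp hX) hloc ε

/-- **The Eisenstein half (the crux's predicate) on X6 ∩ FW-locus at every odd `p`, for some (indeed every) sign, MODULO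
the §4.6 binder ALONE** — verbatim the conclusion of crux `KobayashiLowerHalfSemistable` at such a pair. CONDITIONAL;
closes nothing. [claim: FouquetWan2021, status: under-review] [cite: Kobayashi2003, Thm. 7.4 (p. 13) and Conjecture (p. 2)] -/
theorem X6_kobayashiLowerDivisibility_of_thm451_OPEN (hFW : FouquetWan2021_thm451_via_kobayashi74_OPEN)
    (W : WeierstrassCurve ℚ) [W.IsElliptic] [W.IsGloballyMinimal] (p : ℕ) [Fact p.Prime]
    (hp : p ≠ 2) (hX : ClassX6 W p)
    (hloc : ∃ (ℓ : ℕ) (_ : Fact ℓ.Prime), ℓ ≠ p ∧ W.HasMultiplicativeReductionAtPrime ℓ ∧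
        ¬ W.HasSplitMultiplicativeReductionAtPrime ℓ ∧ ¬ p ∣ padicValInt ℓ W.minimalDiscriminantInt) :
    ∃ ε : ℤˣ, KobayashiLowerDivisibility W p ε :=
  ⟨1, kobayashiLowerDivisibility_of_mainConjecture (X6_kobayashiMainConjecture_of_thm451_OPEN hFW W p hp hX hloc 1)⟩

/-- **The same from the §5 binder** (Fouquet–Wan Thm 5.1 read through Kobayashi Thm 7.4, `FouquetWan2021_thm51_via_kobayashi74_OPEN`,
which implies the §4.6 binder by `thm451_OPEN_of_thm51_OPEN`). CONDITIONAL; closes nothing.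
[claim: FouquetWan2021, status: under-review] [cite: Kobayashi2003, Thm. 7.4 (p. 13)] -/
theorem X6_kobayashiMainConjecture_of_thm51_OPEN (hFW : FouquetWan2021_thm51_via_kobayashi74_OPEN)
    (W : WeierstrassCurve ℚ) [W.IsElliptic] [W.IsGloballyMinimal] (p : ℕ) [Fact p.Prime]
    (hp : p ≠ 2) (hX : ClassX6 W p)
    (hloc : ∃ (ℓ : ℕ) (_ : Fact ℓ.Prime), ℓ ≠ p ∧ W.HasMultiplicativeReductionAtPrime ℓ ∧
        ¬ W.HasSplitMultiplicativeReductionAtPrime ℓ ∧ ¬ p ∣ padicValInt ℓ W.minimalDiscriminantInt)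
    (ε : ℤˣ) : KobayashiMainConjecture W p ε :=
  X6_kobayashiMainConjecture_of_thm451_OPEN (thm451_OPEN_of_thm51_OPEN hFW) W p hp hX hloc ε

/-! ### Class consumers on the locus (A6, D2), every other input published and by name -/

/-- **A6 on the FW locus: `BSD(E,p)` on X6 ∧ {r_an = 0} ∩ FW-locus, every odd `p`, MODULO the ONE Fouquet–Wan §4.6 binder**,
everything else PUBLISHED and by name (Wuthrich Prop. 21 `hW`, Kobayashi Thm. 1.2 `h12`, B. D. Kim Cor. 3.15 `hKim`, Pollack
`hPollack`, modularity `hmodP` / `hmod'`, GZK `hGZK`) — no BSTW tier, no Diamond/Ribet. All 13 A6 window cells are on the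
locus (census k3c2-MEMO-8; they are meanwhile flag-free PER PAIR by other roads). PRE-tier; nothing booked. CONDITIONAL;
closes nothing. [claim: FouquetWan2021, status: under-review] [cite: Wuthrich2014, Prop. 21 (p. 400)]
[cite: Kobayashi2003, Thm. 1.2 and Thm. 7.4] [cite: BDKim2013, Cor. 3.15 (p. 199)] [cite: Miller2011LMS, §1 and Def. 1.1] -/
theorem X6_bsdp_of_thm451_OPEN_of_analyticRank_eq_zero (hFW : FouquetWan2021_thm451_via_kobayashi74_OPEN)
    (hW : Wuthrich2014.sha_dvd_analyticSha)
    (h12 : Kobayashi2003.thm12_signedSelmerDual_finite_torsion)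
    (hKim : BDKim2013.cor315_signedCharValue_rankZero)
    (W : WeierstrassCurve ℚ) [W.IsElliptic] [W.IsGloballyMinimal] (p : ℕ) [Fact p.Prime]
    (hPollack : ∀ {N : ℕ} [NeZero N] {f : CuspForm (Gamma0 N) 2},
      pollack_exists_plusMinusPAdicLFunction (W := W) (f := f) (p := p))
    (hmodP : nonempty_modularParametrizationData) (hmod' : hasEntireLFunction_rat)
    (hGZK : rank_eq_analyticRank_of_analyticRank_le_one)
    (hp : p ≠ 2) (hX : ClassX6 W p)
    (hloc : ∃ (ℓ : ℕ) (_ : Fact ℓ.Prime), ℓ ≠ p ∧ W.HasMultiplicativeReductionAtPrime ℓ ∧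
        ¬ W.HasSplitMultiplicativeReductionAtPrime ℓ ∧ ¬ p ∣ padicValInt ℓ W.minimalDiscriminantInt)
    (h0 : W.analyticRank = 0) : BSDp W p :=
  X6.bsdp_of_kobayashiMainConjecture_of_analyticRank_eq_zero W p hW h12 hKim hPollack hmodP hmod' hGZK hp hX h0
    (X6_kobayashiMainConjecture_of_thm451_OPEN hFW W p hp hX hloc 1)

/-- **D2 / X6 r1 on the FW locus: `BSD(E,p)` on X6 ∧ {r_an = 1} ∩ FW-locus, every odd `p`, MODULO the ONE Fouquet–Wan §4.6
binder**, via Burungale–Kobayashi–Ota 2024 Cor. A.5 (`hA5`, PUB, flags in its docstring), modularity (`hmod'`) and GZK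
(`hGZK`) — no BSTW tier, no JSW chain. PRE-tier; nothing booked. CONDITIONAL; closes nothing.
[claim: FouquetWan2021, status: under-review] [cite: BurungaleKobayashiOta2023, App. A Cor. A.5]
[cite: Kobayashi2003, Thm. 7.4 (p. 13)] [cite: Miller2011LMS, §1 and Def. 1.1] -/
theorem X6_bsdp_of_thm451_OPEN_of_corA5_of_analyticRank_eq_one (hFW : FouquetWan2021_thm451_via_kobayashi74_OPEN)
    (hA5 : BurungaleKobayashiOta2024.corA5_pPart_of_signedCharIdeal_eq) (hmod' : hasEntireLFunction_rat)
    (hGZK : rank_eq_analyticRank_of_analyticRank_le_one)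
    (W : WeierstrassCurve ℚ) [W.IsElliptic] [W.IsGloballyMinimal] (p : ℕ) [Fact p.Prime]
    (hp : p ≠ 2) (hX : ClassX6 W p)
    (hloc : ∃ (ℓ : ℕ) (_ : Fact ℓ.Prime), ℓ ≠ p ∧ W.HasMultiplicativeReductionAtPrime ℓ ∧
        ¬ W.HasSplitMultiplicativeReductionAtPrime ℓ ∧ ¬ p ∣ padicValInt ℓ W.minimalDiscriminantInt)
    (h1 : W.analyticRank = 1) : BSDp W p :=
  bsdp_of_kobayashiMainConjecture_of_corA5_of_analyticRank_eq_one W p hA5 hmod' hGZK hp hX.1.1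
    (ClassX6.frobeniusTrace_eq_zero W p hp hX) h1 1 (X6_kobayashiMainConjecture_of_thm451_OPEN hFW W p hp hX hloc 1)

/-! ### The crux BY NAME, reduced to its off-locus part modulo Fouquet–Wan -/

/-- **Crux 2 BY NAME ⟸ {Fouquet–Wan §4.6 binder, the crux's conclusion on the OFF-LOCUS X6 pairs}.** Modulo the PRE claim
`FouquetWan2021_thm451_via_kobayashi74_OPEN`, the crux `KobayashiLowerHalfSemistable` reduces to the semistable curves at odd
good supersingular `p` having NO non-split multiplicative prime `ℓ ≠ p` with `p ∤ ord_ℓ(Δ_min)` (every multiplicative `ℓ`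
split, or `E[p]` unramified there): whatever else the crux is made to rest on is load-bearing only there. Pure logic over
`X6_kobayashiLowerDivisibility_of_thm451_OPEN`. CONDITIONAL (`conditional-result`); the item stays OPEN.
[claim: FouquetWan2021, status: under-review] [cite: Kobayashi2003, Thm. 7.4 (p. 13) and Conjecture (p. 2)] -/
theorem KobayashiLowerHalfSemistable_of_thm451_OPEN_of_offLocus (hFW : FouquetWan2021_thm451_via_kobayashi74_OPEN)
    (hoff : ∀ (W : WeierstrassCurve ℚ) [W.IsElliptic] [W.IsGloballyMinimal] (p : ℕ) [Fact p.Prime],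
      p ≠ 2 → ClassX6 W p →
      (¬ ∃ (ℓ : ℕ) (_ : Fact ℓ.Prime), ℓ ≠ p ∧ W.HasMultiplicativeReductionAtPrime ℓ ∧
          ¬ W.HasSplitMultiplicativeReductionAtPrime ℓ ∧ ¬ p ∣ padicValInt ℓ W.minimalDiscriminantInt) →
      ∃ ε : ℤˣ, KobayashiLowerDivisibility W p ε) :
    Summit.BirchSwinnertonDyer.BirchSwinnertonDyer.Theses.SignedLowerHalves.KobayashiLowerHalfSemistable := by
  intro W _ _ p _ hp hX
  by_cases hloc : ∃ (ℓ : ℕ) (_ : Fact ℓ.Prime), ℓ ≠ p ∧ W.HasMultiplicativeReductionAtPrime ℓ ∧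
      ¬ W.HasSplitMultiplicativeReductionAtPrime ℓ ∧ ¬ p ∣ padicValInt ℓ W.minimalDiscriminantInt
  · exact X6_kobayashiLowerDivisibility_of_thm451_OPEN hFW W p hp hX hloc
  · exact hoff W p hp hX hloc

/-- **Crux 2 BY NAME ⟸ {Fouquet–Wan §4.6 binder, the two S-scoped BSTW tiers RESTRICTED TO OFF-LOCUS PAIRS, modularity,
Diamond/Ribet}.** The off-locus hypotheses `hoff5` / `hoff3` are the bodies of `BurungaleSkinnerTianWan2024_thm13_scopedS_OPEN`
/ `…_scopedAtThreeS_OPEN` with the extra antecedent "no FW witness prime" — strictly WEAKER than the named tier binders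
(`KobayashiLowerHalfSemistable_of_thm451_OPEN_of_tiersS_S3` below recovers p441716's reading from them); modularity `hmod` and
Diamond 1995 / Ribet 1990 `hLL` make BSTW's scope datum free (`BSTWScope_hasAuxWitness_of_goodSS`). So, granted Fouquet–Wan's
§4.6 claim, the `p = 3` tier — and with it the located residual (3-ii)♭ ([SSV], not public) — is load-bearing ONLY off the FW
locus. CONDITIONAL (`conditional-result`); the item stays OPEN. [claim: FouquetWan2021, status: under-review]
[claim: BurungaleSkinnerTianWan2024, status: under-review] [cite: Kobayashi2003, Conjecture (Main Conjecture) (p. 2)]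
[cite: Ribet1990, Thm. 1.1] [cite: Diamond1995RefinedSerre, Thm. 1.1] -/
theorem KobayashiLowerHalfSemistable_of_thm451_OPEN_of_tiersS_S3_offLocus
    (hFW : FouquetWan2021_thm451_via_kobayashi74_OPEN)
    (hoff5 : ∀ (W : WeierstrassCurve ℚ) [W.IsElliptic] [W.IsGloballyMinimal] (p : ℕ) [Fact p.Prime],
      5 ≤ p → Semistable W → GoodSS W p →
      (¬ ∃ (ℓ : ℕ) (_ : Fact ℓ.Prime), ℓ ≠ p ∧ W.HasMultiplicativeReductionAtPrime ℓ ∧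
          ¬ W.HasSplitMultiplicativeReductionAtPrime ℓ ∧ ¬ p ∣ padicValInt ℓ W.minimalDiscriminantInt) →
      BSTWScope.HasAuxWitness W p → ∀ ε : ℤˣ, KobayashiMainConjecture W p ε)
    (hoff3 : ∀ (W : WeierstrassCurve ℚ) [W.IsElliptic] [W.IsGloballyMinimal] (p : ℕ) [Fact p.Prime],
      p = 3 → Semistable W → GoodSS W p → W.frobeniusTrace 3 = 0 →
      (¬ ∃ (ℓ : ℕ) (_ : Fact ℓ.Prime), ℓ ≠ p ∧ W.HasMultiplicativeReductionAtPrime ℓ ∧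
          ¬ W.HasSplitMultiplicativeReductionAtPrime ℓ ∧ ¬ p ∣ padicValInt ℓ W.minimalDiscriminantInt) →
      BSTWScope.HasAuxWitness W p → ∀ ε : ℤˣ, KobayashiMainConjecture W p ε)
    (hmod : exists_isNewformOf) (hLL : Literature.NumberTheory.Automorphic.diamond1995_refinedSerre) :
    Summit.BirchSwinnertonDyer.BirchSwinnertonDyer.Theses.SignedLowerHalves.KobayashiLowerHalfSemistable := by
  refine KobayashiLowerHalfSemistable_of_thm451_OPEN_of_offLocus hFW ?_
  intro W _ _ p _ hp hX hnloc
  have hpP : p.Prime := Fact.out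
  have hw : BSTWScope.HasAuxWitness W p := BSTWScope_hasAuxWitness_of_goodSS hmod hLL W p hp hX.2.1 hX.1
  refine ⟨1, kobayashiLowerDivisibility_of_mainConjecture ?_⟩
  by_cases h5 : 5 ≤ p
  · exact hoff5 W p h5 hX.2.1 hX.1 hnloc hw 1
  · have h3 : p = 3 := by
      have h2 := hpP.two_le
      interval_cases p
      · exact absurd rfl hp
      · rfl
      · exact absurd hpP (by decide)
    have ha3 : W.frobeniusTrace 3 = 0 := by
      have h := ClassX6.frobeniusTrace_eq_zero W p hp hX
      rw [h3] at h
      exact h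
    exact hoff3 W p h3 hX.2.1 hX.1 ha3 hnloc hw 1

/-- **Sanity composition: the named S-scoped tiers imply their off-locus restrictions**, so the reading above is never
stronger than p441716's `KobayashiLowerHalfSemistable_of_tiersS_S3` together with the FW binder: crux BY NAME ⟸ {§4.6 FW
binder, S-scoped tier @ p ≥ 5, S-scoped tier @ 3, modularity, Diamond/Ribet}. Closes nothing.
[claim: FouquetWan2021, status: under-review] [claim: BurungaleSkinnerTianWan2024, status: under-review] -/
theorem KobayashiLowerHalfSemistable_of_thm451_OPEN_of_tiersS_S3
    (hFW : FouquetWan2021_thm451_via_kobayashi74_OPEN)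
    (hBSTW5 : BurungaleSkinnerTianWan2024_thm13_scopedS_OPEN)
    (hBSTW3 : BurungaleSkinnerTianWan2024_thm13_scopedAtThreeS_OPEN) (hmod : exists_isNewformOf)
    (hLL : Literature.NumberTheory.Automorphic.diamond1995_refinedSerre) :
    Summit.BirchSwinnertonDyer.BirchSwinnertonDyer.Theses.SignedLowerHalves.KobayashiLowerHalfSemistable :=
  KobayashiLowerHalfSemistable_of_thm451_OPEN_of_tiersS_S3_offLocus hFW
    (fun W _ _ p _ h5 hsst hss _ hw ε => hBSTW5 W p h5 hsst hss hw ε)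
    (fun W _ _ p _ h3 hsst hss ha3 _ hw ε => hBSTW3 W p h3 hsst hss ha3 hw ε) hmod hLL

end Summit.BirchSwinnertonDyer.BirchSwinnertonDyer.Theorems

end
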